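import Summits.RiemannHypothesis.RiemannHypothesis.Theses.SpectralTrace
import Summits.RiemannHypothesis.RiemannHypothesis.Theorems.SpectralIsHpSpectrum.Negative.RefutationImpliesRH
import Summits.RiemannHypothesis.RiemannHypothesis.Theorems.WindowTraceArch.Negative.FiniteSpectrum
import Summits.RiemannHypothesis.RiemannHypothesis.Theorems.WindowTraceArch.Negative.LocalWeyl
import Literature.NumberTheory.LFunctions.WeilWindowSimpleEven
import Literature.NumberTheory.LFunctions.WeilMellinBounds
import Literature.NumberTheory.LFunctions.WeilMellinInversion
import Literature.NumberTheory.LFunctions.WeilSmallSupportPositivity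
import Literature.NumberTheory.LFunctions.WeilArchimedeanMoments
import Literature.NumberTheory.LFunctions.WeilArchimedeanPositivityProofs
import Literature.NumberTheory.LFunctions.WeilGroundState
import Mathlib.Logic.Denumerable
import HarnessLib

/-!
# `SpectralThesis` (stmt-RiemannHypothesis-0187): every witness spectrum is two-sided unbounded

Negative lemmas for the route target `X = SpectralThesis` of route SpectralTrace
(refuter / cdisprove seat; supports stmt-RiemannHypothesis-0187). For a real family `γ : ι → ℝ` with
`HasSum (i ↦ ĝ(1/2 + iγ_i)) (W g)` for every Weil test `g` ("trace family"):

* `trace_neg` : the reflected family `-γ` is again a trace family (`W` is even,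
  `weilFunctional_comp_neg`).
* `false_of_trace_le` : the family is NOT bounded above; `exists_gt_of_trace`, `exists_lt_of_trace`,
  `not_bddAbove_of_trace`, `not_bddBelow_of_trace`, `infinite_setOf_pos_of_trace`,
  `infinite_setOf_neg_of_trace`.
  Proof: test the trace against the derivative `k'` of `k = φ ⋆ φ̃`
  (`(k')^(1/2+iγ) = -iγ |φ̂(1/2+iγ)|²`, `weilMellin_deriv`) for `γ` and for `-γ`; subtracting,
  `Σ_i γ_i (|φ̂(½+iγ_i)|² + |φ̂(½-iγ_i)|²) = 0`, while the Bochner form gives total mass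
  `2 Re Q(φ)`; if `γ_i ≤ K` then all but finitely many `γ_i ≤ -1` (local finiteness,
  `finite_abs_le_of_windowTrace`), so `2 Re Q(φ) ≤ 2(K+1)·#F` on the unit `L²`-sphere of thin
  tests, contradicting Bombieri's coercivity `weilQuadratic_coercive`.
* `not_spectralThesis_bddBelow`, `not_spectralThesis_bddAbove`, `not_spectralThesis_nonneg` : the
  natural strengthenings "semibounded spectrum" / "positive energy levels only" of `X` are FALSE —
  no semibounded Hilbert–Pólya Hamiltonian realises the Weil distribution on all Weil tests.
* `countable_of_trace`, `spectralThesis_iff_nat` : every witness is countable (and infinite), so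
  WLOG `ι = ℕ`.
-/

noncomputable section

open Complex Set MeasureTheory Filter

namespace Summit.RiemannHypothesis.RiemannHypothesis.Theorems.SpectralThesis.Negative

open Literature.NumberTheory.LFunctions
open Summit.RiemannHypothesis.RiemannHypothesis.Theorems.WindowTraceArch.Negative
open Summit.RiemannHypothesis.RiemannHypothesis.Theorems.SpectralIsHpSpectrum.Negative

variable {ι : Type*} {γ : ι → ℝ}

/-- **Reflection symmetry of the witness class**: if `γ` reproduces `W` on all Weil tests, so
does `-γ` (`W(g(-·)) = W(g)`, `weilFunctional_comp_neg`; `(g(-·))^(s) = ĝ(1-s)`,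
`weilMellin_comp_neg`). [folklore] -/
theorem trace_neg
    (h : ∀ g : ℝ → ℂ, IsWeilTest g →
      HasSum (fun i => weilMellin g (1 / 2 + (γ i : ℂ) * I)) (weilFunctional g)) :
    ∀ g : ℝ → ℂ, IsWeilTest g →
      HasSum (fun i => weilMellin g (1 / 2 + ((-γ i : ℝ) : ℂ) * I)) (weilFunctional g) := by
  intro g hg
  have h1 := h (fun t => g (-t)) hg.comp_neg
  rw [weilFunctional_comp_neg] at h1
  convert h1 using 2
  rename_i i
  rw [weilMellin_comp_neg]
  congr 1
  push_cast
  ring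

/-- Local finiteness of a trace family (from the landed window lemma). [folklore] -/
theorem finite_abs_le_of_trace
    (h : ∀ g : ℝ → ℂ, IsWeilTest g →
      HasSum (fun i => weilMellin g (1 / 2 + (γ i : ℂ) * I)) (weilFunctional g)) (R : ℝ) :
    {i : ι | |γ i| ≤ R}.Finite :=
  finite_abs_le_of_windowTrace one_pos (fun g hg _ => h g hg) R

/-- **A trace family is not bounded above.** [folklore] -/
theorem false_of_trace_le
    (h : ∀ g : ℝ → ℂ, IsWeilTest g →
      HasSum (fun i => weilMellin g (1 / 2 + (γ i : ℂ) * I)) (weilFunctional g))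
    (K : ℝ) (hK : ∀ i, γ i ≤ K) : False := by
  classical
  -- normalise the bound
  set K' : ℝ := max K 1 with hK'def
  have hKK' : K ≤ K' := le_max_left _ _
  have hK'1 : 1 ≤ K' := le_max_right _ _
  -- the finite exceptional set `F = {i : |γ i| ≤ K'}`; outside it `γ i ≤ -1`
  have hfin : {i : ι | |γ i| ≤ K'}.Finite := finite_abs_le_of_trace h K'
  set F : Finset ι := hfin.toFinset with hFdef
  have hmemF : ∀ i, i ∈ F ↔ |γ i| ≤ K' := fun i => by
    rw [hFdef, Set.Finite.mem_toFinset]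
    rfl
  have hout : ∀ i, i ∉ F → γ i ≤ -1 := by
    intro i hi
    rw [hmemF, abs_le, not_and_or, not_le, not_le] at hi
    rcases hi with hi | hi
    · linarith
    · linarith [hK i]
  -- coercivity constant and a thin test on the unit sphere
  set Λ : ℝ := (K' + 1) * F.card + 1 with hΛ
  obtain ⟨a₀, ha₀, hco⟩ := weilQuadratic_coercive Λ
  set a : ℝ := min a₀ (1 / 2) with ha_def
  have ha : 0 < a := lt_min ha₀ one_half_pos
  have haa₀ : a ≤ a₀ := min_le_left _ _
  have ha2 : a ≤ 1 / 2 := min_le_right _ _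
  obtain ⟨φ, hφ, hφs, hφn⟩ := exists_isWeilTest_sphere ha
  have hlow : Λ * ∫ t, ‖φ t‖ ^ 2 ≤ (weilQuadratic φ).re := hco a ha haa₀ φ hφ hφs
  rw [hφn, mul_one] at hlow
  -- the two Bochner weights and their sums
  set u : ι → ℝ := fun i => ‖weilMellin φ (1 / 2 + (γ i : ℂ) * I)‖ ^ 2 with hu
  set u' : ι → ℝ := fun i => ‖weilMellin φ (1 / 2 + ((-γ i : ℝ) : ℂ) * I)‖ ^ 2 with hu'
  have hsum_u : HasSum u (weilQuadratic φ).re := hasSum_norm_sq_of_trace h hφ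
  have hsum_u' : HasSum u' (weilQuadratic φ).re := hasSum_norm_sq_of_trace (trace_neg h) hφ
  -- thin support: every weight is at most `2a ≤ 1`
  have hN1 : weilNorm1 φ ^ 2 ≤ 2 * a * weilNorm2Sq φ := weilNorm1_sq_le hφ ha hφs
  have hN2 : weilNorm2Sq φ = 1 := hφn
  have hu_le : ∀ i, u i ≤ 1 := by
    intro i
    have h3 := norm_weilMellin_half_line_le hφ (γ i)
    have h4 : u i ≤ weilNorm1 φ ^ 2 := pow_le_pow_left₀ (norm_nonneg _) h3 2
    nlinarith
  have hu'_le : ∀ i, u' i ≤ 1 := by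
    intro i
    have h3 := norm_weilMellin_half_line_le hφ (-γ i)
    have h4 : u' i ≤ weilNorm1 φ ^ 2 := pow_le_pow_left₀ (norm_nonneg _) h3 2
    nlinarith
  have hu0 : ∀ i, 0 ≤ u i := fun i => by positivity
  have hu'0 : ∀ i, 0 ≤ u' i := fun i => by positivity
  -- the derivative test `k' = (φ ⋆ φ̃)'`
  set k : ℝ → ℂ := weilConv φ (weilReflect φ) with hk_def
  have hk : IsWeilTest k := hφ.weilConv hφ.weilReflect
  have hk' : IsWeilTest (deriv k) := hk.deriv
  have hderiv : ∀ t : ℝ, weilMellin (deriv k) (1 / 2 + (t : ℂ) * I) =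
      -((t : ℂ) * I) * ((‖weilMellin φ (1 / 2 + (t : ℂ) * I)‖ ^ 2 : ℝ) : ℂ) := by
    intro t
    rw [weilMellin_deriv hk, hk_def, weilMellin_weilConv_weilReflect_half hφ t]
    ring
  have h1 : HasSum (fun i => -((γ i : ℂ) * I) * ((u i : ℝ) : ℂ)) (weilFunctional (deriv k)) := by
    have := h (deriv k) hk'
    simpa only [hderiv] using this
  have h2 : HasSum (fun i => -(((-γ i : ℝ) : ℂ) * I) * ((u' i : ℝ) : ℂ))
      (weilFunctional (deriv k)) := by
    have := trace_neg h (deriv k) hk'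
    simpa only [hderiv] using this
  -- subtract and take imaginary parts: `Σ_i γ_i (u_i + u'_i) = 0`
  have h12 : HasSum (fun i => -((γ i : ℂ) * I) * ((u i : ℝ) : ℂ) -
      -(((-γ i : ℝ) : ℂ) * I) * ((u' i : ℝ) : ℂ)) 0 := by
    have := h1.sub h2
    rwa [sub_self] at this
  have him := h12.mapL Complex.imCLM
  simp only [Complex.imCLM_apply, map_zero] at him
  have h3 : HasSum (fun i => γ i * (u i + u' i)) 0 := by
    have him' := him.neg
    rw [neg_zero] at him'
    have hfun : (fun i => -(-((γ i : ℂ) * I) * ((u i : ℝ) : ℂ) -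
        -(((-γ i : ℝ) : ℂ) * I) * ((u' i : ℝ) : ℂ)).im) = fun i => γ i * (u i + u' i) := by
      funext i
      simp only [Complex.sub_im, Complex.mul_im, Complex.neg_re, Complex.neg_im, Complex.mul_re,
        Complex.ofReal_re, Complex.ofReal_im, Complex.I_re, Complex.I_im, Complex.ofReal_neg]
      ring
    rw [hfun] at him'
    exact him'
  -- pointwise comparison with a finitely supported majorant
  set v : ι → ℝ := fun i => u i + u' i with hv
  have hv0 : ∀ i, 0 ≤ v i := fun i => add_nonneg (hu0 i) (hu'0 i)
  have hsum_v : HasSum v (2 * (weilQuadratic φ).re) := by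
    have := hsum_u.add hsum_u'
    rwa [← two_mul] at this
  set w : ι → ℝ := fun i => if i ∈ F then v i else 0 with hw
  have hsum_w : HasSum w (∑ i ∈ F, v i) := by
    have hw0 : ∀ i ∉ F, w i = 0 := fun i hi => if_neg hi
    have this : HasSum w (∑ i ∈ F, w i) := hasSum_sum_of_ne_finset_zero hw0
    rwa [Finset.sum_congr rfl (fun i hi => (if_pos hi : w i = v i))] at this
  have hpt : ∀ i, γ i * v i ≤ (K' + 1) * w i - v i := by
    intro i
    by_cases hi : i ∈ F
    · have hwi : w i = v i := if_pos hi
      rw [hwi]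
      have : γ i ≤ K' := (hK i).trans hKK'
      nlinarith [hv0 i]
    · have hwi : w i = 0 := if_neg hi
      rw [hwi]
      have := hout i hi
      nlinarith [hv0 i]
  have hle : (0 : ℝ) ≤ (K' + 1) * (∑ i ∈ F, v i) - 2 * (weilQuadratic φ).re :=
    hasSum_le hpt h3 ((hsum_w.mul_left (K' + 1)).sub hsum_v)
  -- the finite sum is at most `2 · #F`
  have hFsum : ∑ i ∈ F, v i ≤ F.card * 2 := by
    calc ∑ i ∈ F, v i ≤ ∑ _i ∈ F, (2 : ℝ) := Finset.sum_le_sum fun i _ => by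
            have := hu_le i
            have := hu'_le i
            show u i + u' i ≤ 2
            linarith
      _ = F.card * 2 := by rw [Finset.sum_const, nsmul_eq_mul]
  have hmul : (K' + 1) * (∑ i ∈ F, v i) ≤ (K' + 1) * (F.card * 2) :=
    mul_le_mul_of_nonneg_left hFsum (by linarith)
  -- contradiction with coercivity `Λ = (K'+1) #F + 1 ≤ Re Q(φ)`
  have hP : (K' + 1) * ((F.card : ℝ) * 2) = 2 * ((K' + 1) * F.card) := by ring
  rw [hP] at hmul
  linarith

/-- **Unbounded above**: some spectral point exceeds any `K`. [folklore] -/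
theorem exists_gt_of_trace
    (h : ∀ g : ℝ → ℂ, IsWeilTest g →
      HasSum (fun i => weilMellin g (1 / 2 + (γ i : ℂ) * I)) (weilFunctional g)) (K : ℝ) :
    ∃ i, K < γ i := by
  by_contra hK
  exact false_of_trace_le h K fun i => le_of_not_gt fun hi => hK ⟨i, hi⟩

/-- **Unbounded below**: some spectral point is below any `K` (reflection). [folklore] -/
theorem exists_lt_of_trace
    (h : ∀ g : ℝ → ℂ, IsWeilTest g →
      HasSum (fun i => weilMellin g (1 / 2 + (γ i : ℂ) * I)) (weilFunctional g)) (K : ℝ) :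
    ∃ i, γ i < K := by
  obtain ⟨i, hi⟩ := exists_gt_of_trace (trace_neg h) (-K)
  exact ⟨i, by linarith⟩

/-- The range of a trace family is not bounded above. [folklore] -/
theorem not_bddAbove_of_trace
    (h : ∀ g : ℝ → ℂ, IsWeilTest g →
      HasSum (fun i => weilMellin g (1 / 2 + (γ i : ℂ) * I)) (weilFunctional g)) :
    ¬ BddAbove (Set.range γ) := by
  rintro ⟨K, hK⟩
  obtain ⟨i, hi⟩ := exists_gt_of_trace h K
  exact not_le.2 hi (hK ⟨i, rfl⟩)

/-- The range of a trace family is not bounded below. [folklore] -/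
theorem not_bddBelow_of_trace
    (h : ∀ g : ℝ → ℂ, IsWeilTest g →
      HasSum (fun i => weilMellin g (1 / 2 + (γ i : ℂ) * I)) (weilFunctional g)) :
    ¬ BddBelow (Set.range γ) := by
  rintro ⟨K, hK⟩
  obtain ⟨i, hi⟩ := exists_lt_of_trace h K
  exact not_le.2 hi (hK ⟨i, rfl⟩)

/-- Infinitely many spectral points on the positive half-line. [folklore] -/
theorem infinite_setOf_pos_of_trace
    (h : ∀ g : ℝ → ℂ, IsWeilTest g →
      HasSum (fun i => weilMellin g (1 / 2 + (γ i : ℂ) * I)) (weilFunctional g)) :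
    {i : ι | 0 < γ i}.Infinite := by
  intro hfin
  obtain ⟨M, hM⟩ := (hfin.image γ).bddAbove
  refine false_of_trace_le h (max M 0) fun i => ?_
  by_cases hi : 0 < γ i
  · exact (hM ⟨i, hi, rfl⟩).trans (le_max_left _ _)
  · exact (not_lt.1 hi).trans (le_max_right _ _)

/-- Infinitely many spectral points on the negative half-line. [folklore] -/
theorem infinite_setOf_neg_of_trace
    (h : ∀ g : ℝ → ℂ, IsWeilTest g →
      HasSum (fun i => weilMellin g (1 / 2 + (γ i : ℂ) * I)) (weilFunctional g)) :
    {i : ι | γ i < 0}.Infinite := by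
  have := infinite_setOf_pos_of_trace (trace_neg h)
  simpa using this

/-- **No semibounded Hilbert–Pólya spectrum**: the strengthening of `SpectralThesis` by
"`γ` bounded below" is FALSE. [folklore] -/
theorem not_spectralThesis_bddBelow :
    ¬ ∃ (ι : Type) (γ : ι → ℝ), BddBelow (Set.range γ) ∧ ∀ g : ℝ → ℂ, IsWeilTest g →
      HasSum (fun i => weilMellin g (1 / 2 + (γ i : ℂ) * I)) (weilFunctional g) :=
  fun ⟨_, _, hb, h⟩ => not_bddBelow_of_trace h hb

/-- The strengthening of `SpectralThesis` by "`γ` bounded above" is FALSE. [folklore] -/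
theorem not_spectralThesis_bddAbove :
    ¬ ∃ (ι : Type) (γ : ι → ℝ), BddAbove (Set.range γ) ∧ ∀ g : ℝ → ℂ, IsWeilTest g →
      HasSum (fun i => weilMellin g (1 / 2 + (γ i : ℂ) * I)) (weilFunctional g) :=
  fun ⟨_, _, hb, h⟩ => not_bddAbove_of_trace h hb

/-- **"Positive energy levels only" is FALSE**: no family of non-negative reals reproduces `W`
on all Weil tests (the one-sided ordinates `γ_n > 0` of a positive Hamiltonian reproduce at best
the even part of `W`-tests, never `W` itself in this normalisation). [folklore] -/
theorem not_spectralThesis_nonneg :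
    ¬ ∃ (ι : Type) (γ : ι → ℝ), (∀ i, 0 ≤ γ i) ∧ ∀ g : ℝ → ℂ, IsWeilTest g →
      HasSum (fun i => weilMellin g (1 / 2 + (γ i : ℂ) * I)) (weilFunctional g) :=
  fun ⟨_, γ, h0, h⟩ => not_bddBelow_of_trace h ⟨0, by rintro _ ⟨i, rfl⟩; exact h0 i⟩

/-- Every trace family is countable (local finiteness). [folklore] -/
theorem countable_of_trace
    (h : ∀ g : ℝ → ℂ, IsWeilTest g →
      HasSum (fun i => weilMellin g (1 / 2 + (γ i : ℂ) * I)) (weilFunctional g)) :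
    Countable ι := by
  have hcov : (Set.univ : Set ι) = ⋃ n : ℕ, {i : ι | |γ i| ≤ n} := by
    ext i
    simp only [Set.mem_univ, Set.mem_iUnion, Set.mem_setOf_eq, true_iff]
    exact ⟨⌈|γ i|⌉₊, Nat.le_ceil _⟩
  have huniv : (Set.univ : Set ι).Countable := by
    rw [hcov]
    exact Set.countable_iUnion fun n => (finite_abs_le_of_trace h n).countable
  exact Set.countable_univ_iff.1 huniv

/-- **Normal form `ι = ℕ`**: `SpectralThesis` holds iff some SEQUENCE `γ : ℕ → ℝ` reproduces `W`
(every witness is countable and infinite, `infinite_of_windowTrace`). [folklore] -/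
theorem spectralThesis_iff_nat :
    Summit.RiemannHypothesis.RiemannHypothesis.Theses.SpectralTrace.SpectralThesis ↔
      ∃ γ : ℕ → ℝ, ∀ g : ℝ → ℂ, IsWeilTest g →
        HasSum (fun i => weilMellin g (1 / 2 + (γ i : ℂ) * I)) (weilFunctional g) := by
  constructor
  · rintro ⟨ι, γ, h⟩
    haveI := countable_of_trace h
    haveI := infinite_of_windowTrace one_pos (fun g hg _ => h g hg)
    obtain ⟨e⟩ : Nonempty (ι ≃ ℕ) := inferInstance
    refine ⟨γ ∘ e.symm, fun g hg => ?_⟩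
    exact (e.symm.hasSum_iff (f := fun i => weilMellin g (1 / 2 + (γ i : ℂ) * I))).2 (h g hg)
  · rintro ⟨γ, h⟩
    exact ⟨ℕ, γ, h⟩

end Summit.RiemannHypothesis.RiemannHypothesis.Theorems.SpectralThesis.Negative

end
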